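import Summits.AtomisticToContinuum.Crystallization.Theorems.HullExactificationCascadeZeroDefectDensityCapAtomsPattern
import HarnessLib

/-!
# Cap atoms for the birth line of `ZeroDefectDensity` — II: soft shells labelled by a pattern graph
# (route `HullExactificationCascade`, crux `ZeroDefectDensity`, stmt-AtomisticToContinuum-12086; stub `stub_capAtoms`)

Support file (lead c4, stub-worker) for the registered stub `stub_capAtoms` of
`Cruxes/ZeroDefectDensity/Lines/birth.lean`.  The stub's hypotheses say: around `u` every point `v`
with `dist u v ≤ 13/5` is `1/4000`-softly twelve-kissed (all other points at distance `≥ 1 - 1/4000`,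
each either `≤ 1 + 1/4000` — a soft contact — or `≥ 131/100`), and the soft shell of a soft neighbour
`p` of `u` carries a bijection with the fcc or the hcp kissing pattern turning soft contact
(`dist ≤ 1 + 1/400`) into pattern contact (`dist = 1`).  With file I (`…CapAtomsPattern`) such a
bijection becomes a CHART `idx : shell(p) ≃ Fin 12` with `dist ≤ 1 + 1/400 ↔ adj (idx w) (idx w')`
for `adj = fccAdj` or `hcpAdj` (`exists_chart`).  This file derives, for an abstract chart whose
graph has a link labelling (`fcc_link` / `hcp_link`) and given the two halves of the link lemma of the
line as hypotheses, the two metric consequences the stub needs: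

* `euler_quadrilateral`, `sq_dist_lt_of_quad` — Euler's four-point inequality
  `d(a,c)² + d(b,d)² ≤ Σ sides²`; hence a soft 4-cycle with one diagonal `≥ 131/100` has the other
  diagonal of square `< 64/25 = (8/5)²`.
* `chart_far_of_nonsquare` — THE LINK BOUND: two non-adjacent shell points which at some common
  pattern-neighbour `c` form a NON-square pair are `≥ 8/5` apart (the link lemma at apex `p`, vertex
  `c`; in type `(3,4,3,4)` the wrong disjunct is excluded because a square pair and its fourth corner
  form with `c` a soft 4-cycle whose `c`-diagonal is `≥ 131/100`, so the pair is `< 8/5 < 17/10`).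
  Contrapositive `chart_square_of_sq_lt`: a non-adjacent pair of square distance `< 64/25` is
  square-type at every common neighbour.
* `chart_corner` — hence such a pair `a, b` of soft contacts of `c` has a FOURTH CORNER in the shell of
  `p`: a soft contact `x ≠ c` of `a` and `b` which is not a soft contact of `c`.
* `chart_close5` — the closing configuration of file I, read through the chart.
Statements are at the chart tolerance `1/400`; under soft kissing nothing lies at distance in
`(1 + 1/4000, 131/100)` (`soft_contact` / `soft_far`).  No new definitions. [folklore]
-/

noncomputable section

namespace Summit.AtomisticToContinuum.Crystallization.Theorems.ZeroDefectDensityBirth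

open Literature.Geometry.DiscreteGeometry

/-! ## Euler's quadrilateral inequality -/

/-- **Euler's four-point inequality** (registered sub-goal `euler_quadrilateral`, one line): the
squares of the two diagonals sum to at most the squares of the four sides (defect `‖a - b + c - d‖²`).
[folklore] -/
theorem euler_quadrilateral : ∀ (a b c d : EuclideanSpace ℝ (Fin 3)), dist a c ^ 2 + dist b d ^ 2 ≤ dist a b ^ 2 + dist b c ^ 2 + dist c d ^ 2 + dist d a ^ 2 := by
  intro a b c d
  have key : dist a b ^ 2 + dist b c ^ 2 + dist c d ^ 2 + dist d a ^ 2 - (dist a c ^ 2 + dist b d ^ 2) =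
      ‖(a - b) + (c - d)‖ ^ 2 := by
    have e1 : a - c = (a - b) + (b - c) := by abel
    have e2 : b - d = (b - c) + (c - d) := by abel
    have e3 : d - a = -((a - b) + (b - c) + (c - d)) := by abel
    simp only [dist_eq_norm]
    rw [e1, e2, e3, norm_neg]
    generalize a - b = X
    generalize b - c = Y
    generalize c - d = Z
    simp only [norm_add_sq_real, inner_add_left]
    ring
  nlinarith [key, sq_nonneg ‖(a - b) + (c - d)‖]

/-- **The short diagonal of a soft 4-cycle.** Four sides `≤ 1 + 1/4000` and one diagonal `≥ 131/100`
force the other diagonal to have square `< 64/25 = (8/5)²` (indeed `≤ 4(1 + 1/4000)² - 1.31² < 2.286`).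
[folklore] -/
theorem sq_dist_lt_of_quad (a b c d : (EuclideanSpace ℝ (Fin 3))) (h₁ : dist a b ≤ 1 + 1 / 4000) (h₂ : dist b c ≤ 1 + 1 / 4000)
    (h₃ : dist c d ≤ 1 + 1 / 4000) (h₄ : dist d a ≤ 1 + 1 / 4000) (hac : 131 / 100 ≤ dist a c) :
    dist b d ^ 2 < 64 / 25 := by
  have e := euler_quadrilateral a b c d
  have s₁ := pow_le_pow_left₀ dist_nonneg h₁ 2
  have s₂ := pow_le_pow_left₀ dist_nonneg h₂ 2
  have s₃ := pow_le_pow_left₀ dist_nonneg h₃ 2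
  have s₄ := pow_le_pow_left₀ dist_nonneg h₄ 2
  have s₅ := pow_le_pow_left₀ (by norm_num : (0 : ℝ) ≤ 131 / 100) hac 2
  norm_num at s₁ s₂ s₃ s₄ s₅
  linarith

/-! ## Soft-kissing bookkeeping (tolerances `1/400`, `1/4000` and the gap `131/100`) -/

/-- Every other point is at distance `≥ 1 - 1/4000` from a softly kissed point. [folklore] -/
theorem soft_lower {S : Set (EuclideanSpace ℝ (Fin 3))} {u v w : (EuclideanSpace ℝ (Fin 3))} (hsep : ∀ v ∈ S, dist u v ≤ 13 / 5 → ∀ w ∈ S, w ≠ v → 1 - 1 / 4000 ≤ dist v w ∧ (dist v w ≤ 1 + 1 / 4000 ∨ 131 / 100 ≤ dist v w))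
    (hv : v ∈ S) (huv : dist u v ≤ 13 / 5) (hw : w ∈ S) (hwv : w ≠ v) : 1 - 1 / 4000 ≤ dist v w :=
  (hsep v hv huv w hw hwv).1

/-- Below the gap, a `1/400`-soft contact of a softly kissed point is a `1/4000`-soft contact.
[folklore] -/
theorem soft_contact {S : Set (EuclideanSpace ℝ (Fin 3))} {u v w : (EuclideanSpace ℝ (Fin 3))} (hsep : ∀ v ∈ S, dist u v ≤ 13 / 5 → ∀ w ∈ S, w ≠ v → 1 - 1 / 4000 ≤ dist v w ∧ (dist v w ≤ 1 + 1 / 4000 ∨ 131 / 100 ≤ dist v w))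
    (hv : v ∈ S) (huv : dist u v ≤ 13 / 5) (hw : w ∈ S) (hwv : w ≠ v) (h : dist v w ≤ 1 + 1 / 400) :
    dist v w ≤ 1 + 1 / 4000 := by
  rcases (hsep v hv huv w hw hwv).2 with h' | h'
  · exact h'
  · linarith

/-- A non-contact of a softly kissed point is at distance `≥ 131/100`. [folklore] -/
theorem soft_far {S : Set (EuclideanSpace ℝ (Fin 3))} {u v w : (EuclideanSpace ℝ (Fin 3))} (hsep : ∀ v ∈ S, dist u v ≤ 13 / 5 → ∀ w ∈ S, w ≠ v → 1 - 1 / 4000 ≤ dist v w ∧ (dist v w ≤ 1 + 1 / 4000 ∨ 131 / 100 ≤ dist v w))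
    (hv : v ∈ S) (huv : dist u v ≤ 13 / 5) (hw : w ∈ S) (hwv : w ≠ v) (h : ¬ dist v w ≤ 1 + 1 / 4000) :
    131 / 100 ≤ dist v w := by
  rcases (hsep v hv huv w hw hwv).2 with h' | h'
  · exact absurd h' h
  · exact h'

/-! ## Charts: a soft shell labelled by `Fin 12` -/

/-- Reading the chart backwards: for distinct labels, pattern adjacency is soft contact of the
labelled shell points. [folklore] -/
theorem chart_adj_iff {S : Set (EuclideanSpace ℝ (Fin 3))} {p : (EuclideanSpace ℝ (Fin 3))} {adj : Fin 12 → Fin 12 → Prop}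
    (idx : {w : (EuclideanSpace ℝ (Fin 3)) // w ∈ S ∧ w ≠ p ∧ dist p w ≤ 1 + 1 / 400} ≃ Fin 12)
    (hidx : ∀ w w' : {w : (EuclideanSpace ℝ (Fin 3)) // w ∈ S ∧ w ≠ p ∧ dist p w ≤ 1 + 1 / 400}, w ≠ w' → (dist w.1 w'.1 ≤ 1 + 1 / 400 ↔ adj (idx w) (idx w')))
    {i j : Fin 12} (hij : i ≠ j) : adj i j ↔ dist (idx.symm i).1 (idx.symm j).1 ≤ 1 + 1 / 400 := by
  have hne : idx.symm i ≠ idx.symm j := fun h => hij (idx.symm.injective h)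
  have h := hidx (idx.symm i) (idx.symm j) hne
  rw [Equiv.apply_symm_apply, Equiv.apply_symm_apply] at h
  exact h.symm

/-- Distinct labels are distinct points. [folklore] -/
theorem chart_val_ne {S : Set (EuclideanSpace ℝ (Fin 3))} {p : (EuclideanSpace ℝ (Fin 3))} (idx : {w : (EuclideanSpace ℝ (Fin 3)) // w ∈ S ∧ w ≠ p ∧ dist p w ≤ 1 + 1 / 400} ≃ Fin 12)
    {i j : Fin 12} (hij : i ≠ j) : (idx.symm i).1 ≠ (idx.symm j).1 :=
  fun h => hij (idx.symm.injective (Subtype.ext h))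

/-- Shell points of a neighbour `p` of `u` (`dist u p ≤ 11/10`) lie within `13/5` of `u`. [folklore] -/
theorem chart_dist_u {S : Set (EuclideanSpace ℝ (Fin 3))} {u p : (EuclideanSpace ℝ (Fin 3))} (hup : dist u p ≤ 11 / 10) (w : {w : (EuclideanSpace ℝ (Fin 3)) // w ∈ S ∧ w ≠ p ∧ dist p w ≤ 1 + 1 / 400}) :
    dist u w.1 ≤ 13 / 5 := by
  have h1 := w.2.2.2
  have h2 := dist_triangle u p w.1
  linarith

/-- The apex distances: every shell point of `p` is at distance in `[1 - 1/4000, 1 + 1/4000]` from `p`.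
[folklore] -/
theorem chart_apex_band {S : Set (EuclideanSpace ℝ (Fin 3))} {u p : (EuclideanSpace ℝ (Fin 3))} (hsep : ∀ v ∈ S, dist u v ≤ 13 / 5 → ∀ w ∈ S, w ≠ v → 1 - 1 / 4000 ≤ dist v w ∧ (dist v w ≤ 1 + 1 / 4000 ∨ 131 / 100 ≤ dist v w))
    (hp : p ∈ S) (hup : dist u p ≤ 11 / 10) (w : {w : (EuclideanSpace ℝ (Fin 3)) // w ∈ S ∧ w ≠ p ∧ dist p w ≤ 1 + 1 / 400}) :
    1 - 1 / 4000 ≤ dist p w.1 ∧ dist p w.1 ≤ 1 + 1 / 4000 :=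
  ⟨soft_lower hsep hp (by linarith) w.2.1 w.2.2.1,
    soft_contact hsep hp (by linarith) w.2.1 w.2.2.1 w.2.2.2⟩

/-- Pattern-adjacent labels are soft contacts: distance in `[1 - 1/4000, 1 + 1/4000]`. [folklore] -/
theorem chart_adj_band {S : Set (EuclideanSpace ℝ (Fin 3))} {u p : (EuclideanSpace ℝ (Fin 3))} {adj : Fin 12 → Fin 12 → Prop} (hsep : ∀ v ∈ S, dist u v ≤ 13 / 5 → ∀ w ∈ S, w ≠ v → 1 - 1 / 4000 ≤ dist v w ∧ (dist v w ≤ 1 + 1 / 4000 ∨ 131 / 100 ≤ dist v w))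
    (hup : dist u p ≤ 11 / 10) (idx : {w : (EuclideanSpace ℝ (Fin 3)) // w ∈ S ∧ w ≠ p ∧ dist p w ≤ 1 + 1 / 400} ≃ Fin 12)
    (hidx : ∀ w w' : {w : (EuclideanSpace ℝ (Fin 3)) // w ∈ S ∧ w ≠ p ∧ dist p w ≤ 1 + 1 / 400}, w ≠ w' → (dist w.1 w'.1 ≤ 1 + 1 / 400 ↔ adj (idx w) (idx w')))
    (hirr : ∀ i : Fin 12, ¬ adj i i) {i j : Fin 12} (h : adj i j) :
    1 - 1 / 4000 ≤ dist (idx.symm i).1 (idx.symm j).1 ∧ dist (idx.symm i).1 (idx.symm j).1 ≤ 1 + 1 / 4000 := by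
  have hij : i ≠ j := by
    rintro rfl
    exact hirr i h
  have hd := (chart_adj_iff idx hidx hij).1 h
  exact ⟨soft_lower hsep (idx.symm i).2.1 (chart_dist_u hup _) (idx.symm j).2.1 (chart_val_ne idx hij).symm,
    soft_contact hsep (idx.symm i).2.1 (chart_dist_u hup _) (idx.symm j).2.1 (chart_val_ne idx hij).symm hd⟩

/-- Distinct non-adjacent labels are non-contacts: distance `≥ 131/100`. [folklore] -/
theorem chart_far {S : Set (EuclideanSpace ℝ (Fin 3))} {u p : (EuclideanSpace ℝ (Fin 3))} {adj : Fin 12 → Fin 12 → Prop} (hsep : ∀ v ∈ S, dist u v ≤ 13 / 5 → ∀ w ∈ S, w ≠ v → 1 - 1 / 4000 ≤ dist v w ∧ (dist v w ≤ 1 + 1 / 4000 ∨ 131 / 100 ≤ dist v w))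
    (hup : dist u p ≤ 11 / 10) (idx : {w : (EuclideanSpace ℝ (Fin 3)) // w ∈ S ∧ w ≠ p ∧ dist p w ≤ 1 + 1 / 400} ≃ Fin 12)
    (hidx : ∀ w w' : {w : (EuclideanSpace ℝ (Fin 3)) // w ∈ S ∧ w ≠ p ∧ dist p w ≤ 1 + 1 / 400}, w ≠ w' → (dist w.1 w'.1 ≤ 1 + 1 / 400 ↔ adj (idx w) (idx w')))
    {i j : Fin 12} (hij : i ≠ j) (h : ¬ adj i j) : 131 / 100 ≤ dist (idx.symm i).1 (idx.symm j).1 := by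
  have hd : ¬ dist (idx.symm i).1 (idx.symm j).1 ≤ 1 + 1 / 400 := fun hd => h ((chart_adj_iff idx hidx hij).2 hd)
  exact soft_far hsep (idx.symm i).2.1 (chart_dist_u hup _) (idx.symm j).2.1 (chart_val_ne idx hij).symm
    (fun h' => hd (by linarith))

/-! ## The link bound -/

/-- **The link bound.** In a charted soft shell of a neighbour `p` of `u` (soft kissing around `u`,
a link labelling of the pattern graph, both halves of the link lemma): two distinct non-adjacent shell
points which form a NON-square pair at some common pattern-neighbour `c` are at distance `≥ 8/5`.
Proof: label the four neighbours of `c` by the link labelling; all eleven bands of the link lemma at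
apex `p`, vertex `c` hold by soft kissing; in type `(3,4,3,4)` the disjunct putting `17/10` on the
square pair `(n₁,n₂)` is impossible (its fourth corner `k` gives a soft 4-cycle `c n₁ k n₂` with
`dist c k ≥ 131/100`, so `dist n₁ n₂ < 8/5` by Euler); hence both non-square pairs are `≥ 8/5`, and the
given pair is one of them. [folklore] -/
theorem chart_far_of_nonsquare {S : Set (EuclideanSpace ℝ (Fin 3))} {u p : (EuclideanSpace ℝ (Fin 3))} {adj : Fin 12 → Fin 12 → Prop}
    (hsep : ∀ v ∈ S, dist u v ≤ 13 / 5 → ∀ w ∈ S, w ≠ v → 1 - 1 / 4000 ≤ dist v w ∧ (dist v w ≤ 1 + 1 / 4000 ∨ 131 / 100 ≤ dist v w))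
    (hp : p ∈ S) (hup : dist u p ≤ 11 / 10)
    (idx : {w : (EuclideanSpace ℝ (Fin 3)) // w ∈ S ∧ w ≠ p ∧ dist p w ≤ 1 + 1 / 400} ≃ Fin 12)
    (hidx : ∀ w w' : {w : (EuclideanSpace ℝ (Fin 3)) // w ∈ S ∧ w ≠ p ∧ dist p w ≤ 1 + 1 / 400}, w ≠ w' → (dist w.1 w'.1 ≤ 1 + 1 / 400 ↔ adj (idx w) (idx w')))
    (hirr : ∀ i : Fin 12, ¬ adj i i)
    (hlink : ∀ c : Fin 12, ∃ n₀ n₁ n₂ n₃ : Fin 12, adj c n₀ ∧ adj c n₁ ∧ adj c n₂ ∧ adj c n₃ ∧ adj n₀ n₁ ∧ n₀ ≠ n₂ ∧ ¬ adj n₀ n₂ ∧ n₁ ≠ n₃ ∧ ¬ adj n₁ n₃ ∧ n₃ ≠ n₀ ∧ ¬ adj n₃ n₀ ∧ ((adj n₂ n₃ ∧ n₁ ≠ n₂ ∧ ¬ adj n₁ n₂ ∧ ∃ k : Fin 12, k ≠ c ∧ adj k n₁ ∧ adj k n₂ ∧ ¬ adj k c) ∨ (adj n₁ n₂ ∧ n₂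 ≠ n₃ ∧ ¬ adj n₂ n₃)) ∧ ∀ a b : Fin 12, adj c a → adj c b → a ≠ b → ¬ adj a b → (¬ ∃ k : Fin 12, k ≠ c ∧ adj k a ∧ adj k b ∧ ¬ adj k c) → ((a = n₀ ∧ b = n₂) ∨ (a = n₂ ∧ b = n₀) ∨ (a = n₁ ∧ b = n₃) ∨ (a = n₃ ∧ b = n₁)))
    (linkA : ∀ (η : ℝ) (p c n₁ n₂ n₃ n₄ : (EuclideanSpace ℝ (Fin 3))), 0 ≤ η → η ≤ 1 / 1000 → 1 - η ≤ dist c p → dist c p ≤ 1 + η → 1 - η ≤ dist p n₁ → dist p n₁ ≤ 1 + η → 1 - η ≤ dist p n₂ → dist p n₂ ≤ 1 + η → 1 - η ≤ dist p n₃ → dist p n₃ ≤ 1 + η → 1 - η ≤ dist p n₄ → dist p n₄ ≤ 1 + η → 1 - η ≤ dist c n₁ → dist c n₁ ≤ 1 + η → 1 - η ≤ dist c n₂ → dist c n₂ ≤ 1 + η → 1 - η ≤ dist c n₃ → dist c n₃ ≤ 1 + η → 1 - η ≤ dist c n₄ → dist c n₄ ≤ 1 + η → 1 - η ≤ dist n₁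 n₂ → dist n₁ n₂ ≤ 1 + η → 1 - η ≤ dist n₃ n₄ → dist n₃ n₄ ≤ 1 + η → 131 / 100 ≤ dist n₁ n₃ → 131 / 100 ≤ dist n₂ n₄ → 131 / 100 ≤ dist n₂ n₃ → 131 / 100 ≤ dist n₄ n₁ → (17 / 10 ≤ dist n₁ n₃ ∧ 17 / 10 ≤ dist n₂ n₄) ∨ (17 / 10 ≤ dist n₂ n₃ ∧ 17 / 10 ≤ dist n₄ n₁))
    (linkB : ∀ (η : ℝ) (p c n₁ n₂ n₃ n₄ : (EuclideanSpace ℝ (Fin 3))), 0 ≤ η → η ≤ 1 / 1000 → 1 - η ≤ dist c p → dist c p ≤ 1 + η → 1 - η ≤ dist p n₁ → dist p n₁ ≤ 1 + η → 1 - η ≤ dist p n₂ → dist p n₂ ≤ 1 + η → 1 - η ≤ dist p n₃ → dist p n₃ ≤ 1 + η → 1 - η ≤ dist p n₄ → dist p n₄ ≤ 1 + η → 1 - η ≤ dist c n₁ → dist c n₁ ≤ 1 + η → 1 - η ≤ dist c n₂ → dist c n₂ ≤ 1 + η → 1 - η ≤ dist c n₃ → dist c n₃ ≤ 1 + η → 1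 - η ≤ dist c n₄ → dist c n₄ ≤ 1 + η → 1 - η ≤ dist n₁ n₂ → dist n₁ n₂ ≤ 1 + η → 1 - η ≤ dist n₂ n₃ → dist n₂ n₃ ≤ 1 + η → 131 / 100 ≤ dist n₁ n₃ → 131 / 100 ≤ dist n₂ n₄ → 131 / 100 ≤ dist n₃ n₄ → 131 / 100 ≤ dist n₄ n₁ → 8 / 5 ≤ dist n₁ n₃ ∧ 17 / 10 ≤ dist n₂ n₄)
    {i j : Fin 12} (hij : i ≠ j) (hnadj : ¬ adj i j)
    (hc : ∃ c : Fin 12, adj c i ∧ adj c j ∧ ¬ ∃ k : Fin 12, k ≠ c ∧ adj k i ∧ adj k j ∧ ¬ adj k c) :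
    8 / 5 ≤ dist (idx.symm i).1 (idx.symm j).1 := by
  obtain ⟨c, hci, hcj, hns⟩ := hc
  obtain ⟨n₀, n₁, n₂, n₃, h0, h1, h2, h3, h01, hne02, hn02, hne13, hn13, hne30, hn30, htype, hcomp⟩ := hlink c
  have hpair := hcomp i j hci hcj hij hnadj hns
  have AB := chart_apex_band hsep hp hup
  have CB : ∀ {a b : Fin 12}, adj a b →
      1 - 1 / 4000 ≤ dist (idx.symm a).1 (idx.symm b).1 ∧ dist (idx.symm a).1 (idx.symm b).1 ≤ 1 + 1 / 4000 :=
    fun h => chart_adj_band hsep hup idx hidx hirr h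
  have FR : ∀ {a b : Fin 12}, a ≠ b → ¬ adj a b → 131 / 100 ≤ dist (idx.symm a).1 (idx.symm b).1 :=
    fun h h' => chart_far hsep hup idx hidx h h'
  have key : 8 / 5 ≤ dist (idx.symm n₀).1 (idx.symm n₂).1 ∧ 8 / 5 ≤ dist (idx.symm n₁).1 (idx.symm n₃).1 := by
    have hcp := AB (idx.symm c)
    have hp0 := AB (idx.symm n₀)
    have hp1 := AB (idx.symm n₁)
    have hp2 := AB (idx.symm n₂)
    have hp3 := AB (idx.symm n₃)
    have hc0 := CB h0
    have hc1 := CB h1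
    have hc2 := CB h2
    have hc3 := CB h3
    have h01' := CB h01
    have f02 := FR hne02 hn02
    have f13 := FR hne13 hn13
    have f30 := FR hne30 hn30
    rcases htype with ⟨h23, hne12, hn12, k, hkc, hk1, hk2, hknc⟩ | ⟨h12, hne23, hn23⟩
    · have h23' := CB h23
      have f12 := FR hne12 hn12
      have L := linkA (1 / 4000) p (idx.symm c).1 (idx.symm n₀).1 (idx.symm n₁).1 (idx.symm n₂).1
        (idx.symm n₃).1 (by norm_num) (by norm_num)
        (by rw [dist_comm]; exact hcp.1) (by rw [dist_comm]; exact hcp.2)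
        hp0.1 hp0.2 hp1.1 hp1.2 hp2.1 hp2.2 hp3.1 hp3.2
        hc0.1 hc0.2 hc1.1 hc1.2 hc2.1 hc2.2 hc3.1 hc3.2
        h01'.1 h01'.2 h23'.1 h23'.2 f02 f13 f12 f30
      rcases L with ⟨l02, l13⟩ | ⟨l12, -⟩
      · exact ⟨by linarith, by linarith⟩
      · exfalso
        have hk1' := CB hk1
        have hk2' := CB hk2
        have fkc := FR hkc hknc
        have q := sq_dist_lt_of_quad (idx.symm c).1 (idx.symm n₁).1 (idx.symm k).1 (idx.symm n₂).1
          hc1.2 (by rw [dist_comm]; exact hk1'.2) hk2'.2 (by rw [dist_comm]; exact hc2.2)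
          (by rw [dist_comm]; exact fkc)
        nlinarith
    · have h12' := CB h12
      have f23 := FR hne23 hn23
      have L := linkB (1 / 4000) p (idx.symm c).1 (idx.symm n₀).1 (idx.symm n₁).1 (idx.symm n₂).1
        (idx.symm n₃).1 (by norm_num) (by norm_num)
        (by rw [dist_comm]; exact hcp.1) (by rw [dist_comm]; exact hcp.2)
        hp0.1 hp0.2 hp1.1 hp1.2 hp2.1 hp2.2 hp3.1 hp3.2
        hc0.1 hc0.2 hc1.1 hc1.2 hc2.1 hc2.2 hc3.1 hc3.2
        h01'.1 h01'.2 h12'.1 h12'.2 f02 f13 f23 f30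
      exact ⟨L.1, by linarith [L.2]⟩
  rcases hpair with ⟨rfl, rfl⟩ | ⟨rfl, rfl⟩ | ⟨rfl, rfl⟩ | ⟨rfl, rfl⟩
  · exact key.1
  · rw [dist_comm]; exact key.1
  · exact key.2
  · rw [dist_comm]; exact key.2

/-- **Contrapositive: short non-adjacent pairs are square-type everywhere.** Two distinct
non-adjacent shell points at square distance `< 64/25` form a square-type pair at every common
pattern-neighbour. [folklore] -/
theorem chart_square_of_sq_lt {S : Set (EuclideanSpace ℝ (Fin 3))} {u p : (EuclideanSpace ℝ (Fin 3))} {adj : Fin 12 → Fin 12 → Prop}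
    (hsep : ∀ v ∈ S, dist u v ≤ 13 / 5 → ∀ w ∈ S, w ≠ v → 1 - 1 / 4000 ≤ dist v w ∧ (dist v w ≤ 1 + 1 / 4000 ∨ 131 / 100 ≤ dist v w))
    (hp : p ∈ S) (hup : dist u p ≤ 11 / 10)
    (idx : {w : (EuclideanSpace ℝ (Fin 3)) // w ∈ S ∧ w ≠ p ∧ dist p w ≤ 1 + 1 / 400} ≃ Fin 12)
    (hidx : ∀ w w' : {w : (EuclideanSpace ℝ (Fin 3)) // w ∈ S ∧ w ≠ p ∧ dist p w ≤ 1 + 1 / 400}, w ≠ w' → (dist w.1 w'.1 ≤ 1 + 1 / 400 ↔ adj (idx w) (idx w')))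
    (hirr : ∀ i : Fin 12, ¬ adj i i)
    (hlink : ∀ c : Fin 12, ∃ n₀ n₁ n₂ n₃ : Fin 12, adj c n₀ ∧ adj c n₁ ∧ adj c n₂ ∧ adj c n₃ ∧ adj n₀ n₁ ∧ n₀ ≠ n₂ ∧ ¬ adj n₀ n₂ ∧ n₁ ≠ n₃ ∧ ¬ adj n₁ n₃ ∧ n₃ ≠ n₀ ∧ ¬ adj n₃ n₀ ∧ ((adj n₂ n₃ ∧ n₁ ≠ n₂ ∧ ¬ adj n₁ n₂ ∧ ∃ k : Fin 12, k ≠ c ∧ adj k n₁ ∧ adj k n₂ ∧ ¬ adj k c) ∨ (adj n₁ n₂ ∧ n₂ ≠ n₃ ∧ ¬ adj n₂ n₃)) ∧ ∀ a b : Fin 12, adj c a → adj c b → a ≠ b → ¬ adj a b → (¬ ∃ k : Fin 12, k ≠ c ∧ adj k a ∧ adj k b ∧ ¬ adj k c) → ((a = n₀ ∧ b = n₂) ∨ (a = n₂ ∧ b = n₀) ∨ (a = n₁ ∧ b = n₃) ∨ (a = n₃ ∧ b = n₁)))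
    (linkA : ∀ (η : ℝ) (p c n₁ n₂ n₃ n₄ : (EuclideanSpace ℝ (Fin 3))), 0 ≤ η → η ≤ 1 / 1000 → 1 - η ≤ dist c p → dist c p ≤ 1 + η → 1 - η ≤ dist p n₁ → dist p n₁ ≤ 1 + η → 1 - η ≤ dist p n₂ → dist p n₂ ≤ 1 + η → 1 - η ≤ dist p n₃ → dist p n₃ ≤ 1 + η → 1 - η ≤ dist p n₄ → dist p n₄ ≤ 1 + η → 1 - η ≤ dist c n₁ → dist c n₁ ≤ 1 + η → 1 - η ≤ dist c n₂ → dist c n₂ ≤ 1 + η → 1 - η ≤ dist c n₃ → dist c n₃ ≤ 1 + η → 1 - η ≤ dist c n₄ → dist c n₄ ≤ 1 + η → 1 - η ≤ dist n₁ n₂ → dist n₁ n₂ ≤ 1 + η → 1 - η ≤ dist n₃ n₄ → dist n₃ n₄ ≤ 1 + η → 131 / 100 ≤ dist n₁ n₃ → 131 / 100 ≤ dist n₂ n₄ → 131 / 100 ≤ dist n₂ n₃ → 131 / 100 ≤ dist n₄ n₁ → (17 / 10 ≤ dist n₁ n₃ ∧ 17 / 10 ≤ dist n₂ n₄) ∨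 (17 / 10 ≤ dist n₂ n₃ ∧ 17 / 10 ≤ dist n₄ n₁))
    (linkB : ∀ (η : ℝ) (p c n₁ n₂ n₃ n₄ : (EuclideanSpace ℝ (Fin 3))), 0 ≤ η → η ≤ 1 / 1000 → 1 - η ≤ dist c p → dist c p ≤ 1 + η → 1 - η ≤ dist p n₁ → dist p n₁ ≤ 1 + η → 1 - η ≤ dist p n₂ → dist p n₂ ≤ 1 + η → 1 - η ≤ dist p n₃ → dist p n₃ ≤ 1 + η → 1 - η ≤ dist p n₄ → dist p n₄ ≤ 1 + η → 1 - η ≤ dist c n₁ → dist c n₁ ≤ 1 + η → 1 - η ≤ dist c n₂ → dist c n₂ ≤ 1 + η → 1 - η ≤ dist c n₃ → dist c n₃ ≤ 1 + η → 1 - η ≤ dist c n₄ → dist c n₄ ≤ 1 + η → 1 - η ≤ dist n₁ n₂ → dist n₁ n₂ ≤ 1 + η → 1 - η ≤ dist n₂ n₃ → dist n₂ n₃ ≤ 1 + η → 131 / 100 ≤ dist n₁ n₃ → 131 / 100 ≤ dist n₂ n₄ → 131 / 100 ≤ dist n₃ n₄ → 131 / 100 ≤ dist n₄ n₁ → 8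 / 5 ≤ dist n₁ n₃ ∧ 17 / 10 ≤ dist n₂ n₄)
    {i j : Fin 12} (hij : i ≠ j) (hnadj : ¬ adj i j)
    (hlt : dist (idx.symm i).1 (idx.symm j).1 ^ 2 < 64 / 25) :
    ∀ c : Fin 12, adj c i → adj c j → ∃ k : Fin 12, k ≠ c ∧ adj k i ∧ adj k j ∧ ¬ adj k c := by
  intro c hci hcj
  by_contra hns
  have h := chart_far_of_nonsquare hsep hp hup idx hidx hirr hlink linkA linkB hij hnadj ⟨c, hci, hcj, hns⟩
  have h2 := pow_le_pow_left₀ (by norm_num : (0 : ℝ) ≤ 8 / 5) h 2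
  norm_num at h2
  linarith

/-! ## The two consequences used by the stub, in metric terms -/

/-- **Fourth corners exist.** In a charted soft shell of `p`: if `c, a, b` are shell points, `a, b`
distinct soft contacts of `c`, not soft contacts of each other, with `dist a b ² < 64/25`, then some
shell point `x ≠ c` is a soft contact of `a` and of `b` and not of `c` (the fourth corner of the
pattern square `c a · b`). [folklore] -/
theorem chart_corner {S : Set (EuclideanSpace ℝ (Fin 3))} {u p : (EuclideanSpace ℝ (Fin 3))} {adj : Fin 12 → Fin 12 → Prop}
    (hsep : ∀ v ∈ S, dist u v ≤ 13 / 5 → ∀ w ∈ S, w ≠ v → 1 - 1 / 4000 ≤ dist v w ∧ (dist v w ≤ 1 + 1 / 4000 ∨ 131 / 100 ≤ dist v w))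
    (hp : p ∈ S) (hup : dist u p ≤ 11 / 10)
    (idx : {w : (EuclideanSpace ℝ (Fin 3)) // w ∈ S ∧ w ≠ p ∧ dist p w ≤ 1 + 1 / 400} ≃ Fin 12)
    (hidx : ∀ w w' : {w : (EuclideanSpace ℝ (Fin 3)) // w ∈ S ∧ w ≠ p ∧ dist p w ≤ 1 + 1 / 400}, w ≠ w' → (dist w.1 w'.1 ≤ 1 + 1 / 400 ↔ adj (idx w) (idx w')))
    (hirr : ∀ i : Fin 12, ¬ adj i i)
    (hlink : ∀ c : Fin 12, ∃ n₀ n₁ n₂ n₃ : Fin 12, adj c n₀ ∧ adj c n₁ ∧ adj c n₂ ∧ adj c n₃ ∧ adj n₀ n₁ ∧ n₀ ≠ n₂ ∧ ¬ adj n₀ n₂ ∧ n₁ ≠ n₃ ∧ ¬ adj n₁ n₃ ∧ n₃ ≠ n₀ ∧ ¬ adj n₃ n₀ ∧ ((adj n₂ n₃ ∧ n₁ ≠ n₂ ∧ ¬ adj n₁ n₂ ∧ ∃ k : Fin 12, k ≠ c ∧ adj k n₁ ∧ adj k n₂ ∧ ¬ adj k c) ∨ (adj n₁ n₂ ∧ n₂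 ≠ n₃ ∧ ¬ adj n₂ n₃)) ∧ ∀ a b : Fin 12, adj c a → adj c b → a ≠ b → ¬ adj a b → (¬ ∃ k : Fin 12, k ≠ c ∧ adj k a ∧ adj k b ∧ ¬ adj k c) → ((a = n₀ ∧ b = n₂) ∨ (a = n₂ ∧ b = n₀) ∨ (a = n₁ ∧ b = n₃) ∨ (a = n₃ ∧ b = n₁)))
    (linkA : ∀ (η : ℝ) (p c n₁ n₂ n₃ n₄ : (EuclideanSpace ℝ (Fin 3))), 0 ≤ η → η ≤ 1 / 1000 → 1 - η ≤ dist c p → dist c p ≤ 1 + η → 1 - η ≤ dist p n₁ → dist p n₁ ≤ 1 + η → 1 - η ≤ dist p n₂ → dist p n₂ ≤ 1 + η → 1 - η ≤ dist p n₃ → dist p n₃ ≤ 1 + η → 1 - η ≤ dist p n₄ → dist p n₄ ≤ 1 + η → 1 - η ≤ dist c n₁ → dist c n₁ ≤ 1 + η → 1 - η ≤ dist c n₂ → dist c n₂ ≤ 1 + η → 1 - η ≤ dist c n₃ → dist c n₃ ≤ 1 + η → 1 - η ≤ dist c n₄ → dist c n₄ ≤ 1 + η → 1 - η ≤ dist n₁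 n₂ → dist n₁ n₂ ≤ 1 + η → 1 - η ≤ dist n₃ n₄ → dist n₃ n₄ ≤ 1 + η → 131 / 100 ≤ dist n₁ n₃ → 131 / 100 ≤ dist n₂ n₄ → 131 / 100 ≤ dist n₂ n₃ → 131 / 100 ≤ dist n₄ n₁ → (17 / 10 ≤ dist n₁ n₃ ∧ 17 / 10 ≤ dist n₂ n₄) ∨ (17 / 10 ≤ dist n₂ n₃ ∧ 17 / 10 ≤ dist n₄ n₁))
    (linkB : ∀ (η : ℝ) (p c n₁ n₂ n₃ n₄ : (EuclideanSpace ℝ (Fin 3))), 0 ≤ η → η ≤ 1 / 1000 → 1 - η ≤ dist c p → dist c p ≤ 1 + η → 1 - η ≤ dist p n₁ → dist p n₁ ≤ 1 + η → 1 - η ≤ dist p n₂ → dist p n₂ ≤ 1 + η → 1 - η ≤ dist p n₃ → dist p n₃ ≤ 1 + η → 1 - η ≤ dist p n₄ → dist p n₄ ≤ 1 + η → 1 - η ≤ dist c n₁ → dist c n₁ ≤ 1 + η → 1 - η ≤ dist c n₂ → dist c n₂ ≤ 1 + η → 1 - η ≤ dist c n₃ → dist c n₃ ≤ 1 + η → 1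 - η ≤ dist c n₄ → dist c n₄ ≤ 1 + η → 1 - η ≤ dist n₁ n₂ → dist n₁ n₂ ≤ 1 + η → 1 - η ≤ dist n₂ n₃ → dist n₂ n₃ ≤ 1 + η → 131 / 100 ≤ dist n₁ n₃ → 131 / 100 ≤ dist n₂ n₄ → 131 / 100 ≤ dist n₃ n₄ → 131 / 100 ≤ dist n₄ n₁ → 8 / 5 ≤ dist n₁ n₃ ∧ 17 / 10 ≤ dist n₂ n₄)
    {c a b : (EuclideanSpace ℝ (Fin 3))} (hc : c ∈ S) (hcp : c ≠ p) (hpc : dist p c ≤ 1 + 1 / 400)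
    (ha : a ∈ S) (hap : a ≠ p) (hpa : dist p a ≤ 1 + 1 / 400)
    (hb : b ∈ S) (hbp : b ≠ p) (hpb : dist p b ≤ 1 + 1 / 400)
    (hca : c ≠ a) (hcb : c ≠ b) (hab : a ≠ b)
    (hdca : dist c a ≤ 1 + 1 / 400) (hdcb : dist c b ≤ 1 + 1 / 400) (hdab : ¬ dist a b ≤ 1 + 1 / 400)
    (hlt : dist a b ^ 2 < 64 / 25) :
    ∃ x ∈ S, x ≠ p ∧ dist p x ≤ 1 + 1 / 400 ∧ x ≠ c ∧ dist x a ≤ 1 + 1 / 400 ∧ dist x b ≤ 1 + 1 / 400 ∧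
      ¬ dist x c ≤ 1 + 1 / 400 := by
  set C : {w : (EuclideanSpace ℝ (Fin 3)) // w ∈ S ∧ w ≠ p ∧ dist p w ≤ 1 + 1 / 400} := ⟨c, hc, hcp, hpc⟩ with hC
  set A : {w : (EuclideanSpace ℝ (Fin 3)) // w ∈ S ∧ w ≠ p ∧ dist p w ≤ 1 + 1 / 400} := ⟨a, ha, hap, hpa⟩ with hA
  set B : {w : (EuclideanSpace ℝ (Fin 3)) // w ∈ S ∧ w ≠ p ∧ dist p w ≤ 1 + 1 / 400} := ⟨b, hb, hbp, hpb⟩ with hB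
  have hCA : C ≠ A := fun h => hca (congrArg Subtype.val h)
  have hCB : C ≠ B := fun h => hcb (congrArg Subtype.val h)
  have hAB : A ≠ B := fun h => hab (congrArg Subtype.val h)
  have aCA : adj (idx C) (idx A) := (hidx C A hCA).1 hdca
  have aCB : adj (idx C) (idx B) := (hidx C B hCB).1 hdcb
  have nAB : ¬ adj (idx A) (idx B) := fun h => hdab ((hidx A B hAB).2 h)
  have hiAB : idx A ≠ idx B := fun h => hAB (idx.injective h)
  have hlt' : dist (idx.symm (idx A)).1 (idx.symm (idx B)).1 ^ 2 < 64 / 25 := by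
    rw [Equiv.symm_apply_apply, Equiv.symm_apply_apply]; exact hlt
  obtain ⟨k, hkC, hkA, hkB, hknC⟩ :=
    chart_square_of_sq_lt hsep hp hup idx hidx hirr hlink linkA linkB hiAB nAB hlt' (idx C) aCA aCB
  have hXC : idx.symm k ≠ C := fun h => hkC (by rw [← h, Equiv.apply_symm_apply])
  have hXA : idx.symm k ≠ A := by
    intro h
    rw [← h, Equiv.apply_symm_apply] at hkA
    exact hirr k hkA
  have hXB : idx.symm k ≠ B := by
    intro h
    rw [← h, Equiv.apply_symm_apply] at hkB
    exact hirr k hkB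
  refine ⟨(idx.symm k).1, (idx.symm k).2.1, (idx.symm k).2.2.1, (idx.symm k).2.2.2,
    fun h => hXC (Subtype.ext h), ?_, ?_, ?_⟩
  · exact (hidx (idx.symm k) A hXA).2 (by rw [Equiv.apply_symm_apply]; exact hkA)
  · exact (hidx (idx.symm k) B hXB).2 (by rw [Equiv.apply_symm_apply]; exact hkB)
  · intro h
    apply hknC
    have h' := (hidx (idx.symm k) C hXC).1 h
    rw [Equiv.apply_symm_apply] at h'
    exact h'

/-- **The closing configuration, metrically.** In a charted soft shell of `p` whose pattern graph
satisfies the closing property (`fcc_close5` / `hcp_close5`): shell points `v, a, b, x, y` with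
`v ~ a`, `v ~ b`, `a ≠ b`, `a ≁ b`, `x ~ a`, `x ≠ v`, `x ≁ v`, `y ~ b`, `y ≠ v`, `y ≁ v` (soft contacts at
tolerance `1/400`) and `dist a b ², dist v x ², dist v y ² < 64/25`, `dist x y ² < 64/25` unless `x = y`,
satisfy `x = y`. [folklore] -/
theorem chart_close5 {S : Set (EuclideanSpace ℝ (Fin 3))} {u p : (EuclideanSpace ℝ (Fin 3))} {adj : Fin 12 → Fin 12 → Prop}
    (hsep : ∀ v ∈ S, dist u v ≤ 13 / 5 → ∀ w ∈ S, w ≠ v → 1 - 1 / 4000 ≤ dist v w ∧ (dist v w ≤ 1 + 1 / 4000 ∨ 131 / 100 ≤ dist v w))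
    (hp : p ∈ S) (hup : dist u p ≤ 11 / 10)
    (idx : {w : (EuclideanSpace ℝ (Fin 3)) // w ∈ S ∧ w ≠ p ∧ dist p w ≤ 1 + 1 / 400} ≃ Fin 12)
    (hidx : ∀ w w' : {w : (EuclideanSpace ℝ (Fin 3)) // w ∈ S ∧ w ≠ p ∧ dist p w ≤ 1 + 1 / 400}, w ≠ w' → (dist w.1 w'.1 ≤ 1 + 1 / 400 ↔ adj (idx w) (idx w')))
    (hirr : ∀ i : Fin 12, ¬ adj i i)
    (hlink : ∀ c : Fin 12, ∃ n₀ n₁ n₂ n₃ : Fin 12, adj c n₀ ∧ adj c n₁ ∧ adj c n₂ ∧ adj c n₃ ∧ adj n₀ n₁ ∧ n₀ ≠ n₂ ∧ ¬ adj n₀ n₂ ∧ n₁ ≠ n₃ ∧ ¬ adj n₁ n₃ ∧ n₃ ≠ n₀ ∧ ¬ adj n₃ n₀ ∧ ((adj n₂ n₃ ∧ n₁ ≠ n₂ ∧ ¬ adj n₁ n₂ ∧ ∃ k : Fin 12, k ≠ c ∧ adj k n₁ ∧ adj k n₂ ∧ ¬ adj k c) ∨ (adj n₁ n₂ ∧ n₂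 ≠ n₃ ∧ ¬ adj n₂ n₃)) ∧ ∀ a b : Fin 12, adj c a → adj c b → a ≠ b → ¬ adj a b → (¬ ∃ k : Fin 12, k ≠ c ∧ adj k a ∧ adj k b ∧ ¬ adj k c) → ((a = n₀ ∧ b = n₂) ∨ (a = n₂ ∧ b = n₀) ∨ (a = n₁ ∧ b = n₃) ∨ (a = n₃ ∧ b = n₁)))
    (linkA : ∀ (η : ℝ) (p c n₁ n₂ n₃ n₄ : (EuclideanSpace ℝ (Fin 3))), 0 ≤ η → η ≤ 1 / 1000 → 1 - η ≤ dist c p → dist c p ≤ 1 + η → 1 - η ≤ dist p n₁ → dist p n₁ ≤ 1 + η → 1 - η ≤ dist p n₂ → dist p n₂ ≤ 1 + η → 1 - η ≤ dist p n₃ → dist p n₃ ≤ 1 + η → 1 - η ≤ dist p n₄ → dist p n₄ ≤ 1 + η → 1 - η ≤ dist c n₁ → dist c n₁ ≤ 1 + η → 1 - η ≤ dist c n₂ → dist c n₂ ≤ 1 + η → 1 - η ≤ dist c n₃ → dist c n₃ ≤ 1 + η → 1 - η ≤ dist c n₄ → dist c n₄ ≤ 1 + η → 1 - η ≤ dist n₁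 n₂ → dist n₁ n₂ ≤ 1 + η → 1 - η ≤ dist n₃ n₄ → dist n₃ n₄ ≤ 1 + η → 131 / 100 ≤ dist n₁ n₃ → 131 / 100 ≤ dist n₂ n₄ → 131 / 100 ≤ dist n₂ n₃ → 131 / 100 ≤ dist n₄ n₁ → (17 / 10 ≤ dist n₁ n₃ ∧ 17 / 10 ≤ dist n₂ n₄) ∨ (17 / 10 ≤ dist n₂ n₃ ∧ 17 / 10 ≤ dist n₄ n₁))
    (linkB : ∀ (η : ℝ) (p c n₁ n₂ n₃ n₄ : (EuclideanSpace ℝ (Fin 3))), 0 ≤ η → η ≤ 1 / 1000 → 1 - η ≤ dist c p → dist c p ≤ 1 + η → 1 - η ≤ dist p n₁ → dist p n₁ ≤ 1 + η → 1 - η ≤ dist p n₂ → dist p n₂ ≤ 1 + η → 1 - η ≤ dist p n₃ → dist p n₃ ≤ 1 + η → 1 - η ≤ dist p n₄ → dist p n₄ ≤ 1 + η → 1 - η ≤ dist c n₁ → dist c n₁ ≤ 1 + η → 1 - η ≤ dist c n₂ → dist c n₂ ≤ 1 + η → 1 - η ≤ dist c n₃ → dist c n₃ ≤ 1 + η → 1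 - η ≤ dist c n₄ → dist c n₄ ≤ 1 + η → 1 - η ≤ dist n₁ n₂ → dist n₁ n₂ ≤ 1 + η → 1 - η ≤ dist n₂ n₃ → dist n₂ n₃ ≤ 1 + η → 131 / 100 ≤ dist n₁ n₃ → 131 / 100 ≤ dist n₂ n₄ → 131 / 100 ≤ dist n₃ n₄ → 131 / 100 ≤ dist n₄ n₁ → 8 / 5 ≤ dist n₁ n₃ ∧ 17 / 10 ≤ dist n₂ n₄)
    (hcl : ∀ v a b x y : Fin 12, adj v a → adj v b → a ≠ b → ¬ adj a b → adj x a → x ≠ v → ¬ adj x v → adj y b → y ≠ v → ¬ adj y v → (∀ c : Fin 12, adj c a → adj c b → ∃ k : Fin 12, k ≠ c ∧ adj k a ∧ adj k b ∧ ¬ adj k c) → (∀ c : Fin 12, adj c v → adj c x → ∃ k : Fin 12, k ≠ c ∧ adj k v ∧ adj k x ∧ ¬ adj k c) → (∀ c : Fin 12, adj c v → adj c y → ∃ k : Fin 12, k ≠ c ∧ adj k v ∧ adj k y ∧ ¬ adj k c) → (x ≠ y → ¬ adj x y → ∀ c : Fin 12, adj c x → adj c y → ∃ k : Fin 12, k ≠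 c ∧ adj k x ∧ adj k y ∧ ¬ adj k c) → x = y)
    {v a b x y : (EuclideanSpace ℝ (Fin 3))} (hv : v ∈ S) (hvp : v ≠ p) (hpv : dist p v ≤ 1 + 1 / 400)
    (ha : a ∈ S) (hap : a ≠ p) (hpa : dist p a ≤ 1 + 1 / 400)
    (hb : b ∈ S) (hbp : b ≠ p) (hpb : dist p b ≤ 1 + 1 / 400)
    (hx : x ∈ S) (hxp : x ≠ p) (hpx : dist p x ≤ 1 + 1 / 400)
    (hy : y ∈ S) (hyp : y ≠ p) (hpy : dist p y ≤ 1 + 1 / 400)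
    (hva : v ≠ a) (hdva : dist v a ≤ 1 + 1 / 400) (hvb : v ≠ b) (hdvb : dist v b ≤ 1 + 1 / 400)
    (hab : a ≠ b) (hdab : ¬ dist a b ≤ 1 + 1 / 400)
    (hxa : x ≠ a) (hdxa : dist x a ≤ 1 + 1 / 400) (hxv : x ≠ v) (hdxv : ¬ dist x v ≤ 1 + 1 / 400)
    (hyb : y ≠ b) (hdyb : dist y b ≤ 1 + 1 / 400) (hyv : y ≠ v) (hdyv : ¬ dist y v ≤ 1 + 1 / 400)
    (hab2 : dist a b ^ 2 < 64 / 25) (hvx2 : dist v x ^ 2 < 64 / 25) (hvy2 : dist v y ^ 2 < 64 / 25)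
    (hxy2 : x ≠ y → dist x y ^ 2 < 64 / 25) : x = y := by
  set V : {w : (EuclideanSpace ℝ (Fin 3)) // w ∈ S ∧ w ≠ p ∧ dist p w ≤ 1 + 1 / 400} := ⟨v, hv, hvp, hpv⟩ with hV
  set A : {w : (EuclideanSpace ℝ (Fin 3)) // w ∈ S ∧ w ≠ p ∧ dist p w ≤ 1 + 1 / 400} := ⟨a, ha, hap, hpa⟩ with hA
  set B : {w : (EuclideanSpace ℝ (Fin 3)) // w ∈ S ∧ w ≠ p ∧ dist p w ≤ 1 + 1 / 400} := ⟨b, hb, hbp, hpb⟩ with hB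
  set X : {w : (EuclideanSpace ℝ (Fin 3)) // w ∈ S ∧ w ≠ p ∧ dist p w ≤ 1 + 1 / 400} := ⟨x, hx, hxp, hpx⟩ with hX
  set Y : {w : (EuclideanSpace ℝ (Fin 3)) // w ∈ S ∧ w ≠ p ∧ dist p w ≤ 1 + 1 / 400} := ⟨y, hy, hyp, hpy⟩ with hY
  have SQ : ∀ {P Q : {w : (EuclideanSpace ℝ (Fin 3)) // w ∈ S ∧ w ≠ p ∧ dist p w ≤ 1 + 1 / 400}}, P ≠ Q → ¬ dist P.1 Q.1 ≤ 1 + 1 / 400 → dist P.1 Q.1 ^ 2 < 64 / 25 →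
      ∀ c : Fin 12, adj c (idx P) → adj c (idx Q) →
        ∃ k : Fin 12, k ≠ c ∧ adj k (idx P) ∧ adj k (idx Q) ∧ ¬ adj k c := by
    intro P Q hPQ hfar hlt
    refine chart_square_of_sq_lt hsep hp hup idx hidx hirr hlink linkA linkB
      (fun h => hPQ (idx.injective h)) (fun h => hfar ((hidx P Q hPQ).2 h)) ?_
    rw [Equiv.symm_apply_apply, Equiv.symm_apply_apply]; exact hlt
  have hVA : V ≠ A := fun h => hva (congrArg Subtype.val h)
  have hVB : V ≠ B := fun h => hvb (congrArg Subtype.val h)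
  have hAB : A ≠ B := fun h => hab (congrArg Subtype.val h)
  have hXA : X ≠ A := fun h => hxa (congrArg Subtype.val h)
  have hXV : X ≠ V := fun h => hxv (congrArg Subtype.val h)
  have hYB : Y ≠ B := fun h => hyb (congrArg Subtype.val h)
  have hYV : Y ≠ V := fun h => hyv (congrArg Subtype.val h)
  have key := hcl (idx V) (idx A) (idx B) (idx X) (idx Y)
    ((hidx V A hVA).1 hdva) ((hidx V B hVB).1 hdvb) (fun h => hAB (idx.injective h))
    (fun h => hdab ((hidx A B hAB).2 h))
    ((hidx X A hXA).1 hdxa) (fun h => hXV (idx.injective h)) (fun h => hdxv ((hidx X V hXV).2 h))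
    ((hidx Y B hYB).1 hdyb) (fun h => hYV (idx.injective h)) (fun h => hdyv ((hidx Y V hYV).2 h))
    (SQ hAB hdab hab2)
    (SQ hXV.symm (fun h => hdxv (by rw [dist_comm]; exact h)) hvx2)
    (SQ hYV.symm (fun h => hdyv (by rw [dist_comm]; exact h)) hvy2)
    (fun hne hnadj => SQ (fun h => hne (congrArg idx h))
      (fun h => hnadj ((hidx X Y (fun h' => hne (congrArg idx h'))).1 h))
      (hxy2 (fun h => hne (congrArg idx (Subtype.ext h)))))
  exact congrArg Subtype.val (idx.injective key)

/-! ## From the `LocalHalesKernel` conclusion to a chart -/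

/-- **Charts exist.** The conclusion of `LocalHalesKernel` at `p` (a bijection of the `1/400`-soft
shell of `p` with the fcc or the hcp kissing pattern turning soft contact into `dist = 1`) yields a
labelling of the shell by `Fin 12` turning soft contact into `fccAdj` or `hcpAdj` — an irreflexive
graph with a link labelling and the closing property (file I). [folklore] -/
theorem exists_chart {S : Set (EuclideanSpace ℝ (Fin 3))} {p : (EuclideanSpace ℝ (Fin 3))}
    (hiso : ((∃ e : {w : (EuclideanSpace ℝ (Fin 3)) // w ∈ S ∧ w ≠ p ∧ dist p w ≤ 1 + 1 / 400} ≃ {q : (EuclideanSpace ℝ (Fin 3)) // q ∈ Literature.Geometry.DiscreteGeometry.fccKissingPattern}, ∀ w w' : {w : (EuclideanSpace ℝ (Fin 3)) // w ∈ S ∧ w ≠ p ∧ dist p w ≤ 1 + 1 / 400}, w ≠ w' → (dist w.1 w'.1 ≤ 1 + 1 / 400 ↔ dist (e w).1 (e w').1 = 1)) ∨ (∃ e : {w : (EuclideanSpace ℝ (Fin 3)) // w ∈ S ∧ w ≠ p ∧ dist p w ≤ 1 + 1 / 400} ≃ {q : (EuclideanSpace ℝ (Fin 3)) // q ∈ Literature.Geometry.DiscreteGeometry.hcpKissingPattern},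 ∀ w w' : {w : (EuclideanSpace ℝ (Fin 3)) // w ∈ S ∧ w ≠ p ∧ dist p w ≤ 1 + 1 / 400}, w ≠ w' → (dist w.1 w'.1 ≤ 1 + 1 / 400 ↔ dist (e w).1 (e w').1 = 1)))) :
    ∃ (adj : Fin 12 → Fin 12 → Prop) (idx : {w : (EuclideanSpace ℝ (Fin 3)) // w ∈ S ∧ w ≠ p ∧ dist p w ≤ 1 + 1 / 400} ≃ Fin 12),
      (∀ w w' : {w : (EuclideanSpace ℝ (Fin 3)) // w ∈ S ∧ w ≠ p ∧ dist p w ≤ 1 + 1 / 400}, w ≠ w' → (dist w.1 w'.1 ≤ 1 + 1 / 400 ↔ adj (idx w) (idx w'))) ∧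
      (∀ i : Fin 12, ¬ adj i i) ∧
      (∀ c : Fin 12, ∃ n₀ n₁ n₂ n₃ : Fin 12, adj c n₀ ∧ adj c n₁ ∧ adj c n₂ ∧ adj c n₃ ∧ adj n₀ n₁ ∧ n₀ ≠ n₂ ∧ ¬ adj n₀ n₂ ∧ n₁ ≠ n₃ ∧ ¬ adj n₁ n₃ ∧ n₃ ≠ n₀ ∧ ¬ adj n₃ n₀ ∧ ((adj n₂ n₃ ∧ n₁ ≠ n₂ ∧ ¬ adj n₁ n₂ ∧ ∃ k : Fin 12, k ≠ c ∧ adj k n₁ ∧ adj k n₂ ∧ ¬ adj k c) ∨ (adj n₁ n₂ ∧ n₂ ≠ n₃ ∧ ¬ adj n₂ n₃)) ∧ ∀ a b : Fin 12, adj c a → adj c b → a ≠ b → ¬ adj a b → (¬ ∃ k : Fin 12, k ≠ c ∧ adj k a ∧ adj k b ∧ ¬ adj k c) → ((a = n₀ ∧ b = n₂) ∨ (a = n₂ ∧ b = n₀) ∨ (a = n₁ ∧ b = n₃) ∨ (a = n₃ ∧ b = n₁))) ∧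
      (∀ v a b x y : Fin 12, adj v a → adj v b → a ≠ b → ¬ adj a b → adj x a → x ≠ v → ¬ adj x v → adj y b → y ≠ v → ¬ adj y v → (∀ c : Fin 12, adj c a → adj c b → ∃ k : Fin 12, k ≠ c ∧ adj k a ∧ adj k b ∧ ¬ adj k c) → (∀ c : Fin 12, adj c v → adj c x → ∃ k : Fin 12, k ≠ c ∧ adj k v ∧ adj k x ∧ ¬ adj k c) → (∀ c : Fin 12, adj c v → adj c y → ∃ k : Fin 12, k ≠ c ∧ adj k v ∧ adj k y ∧ ¬ adj k c) → (x ≠ y → ¬ adj x y → ∀ c : Fin 12, adj c x → adj c y → ∃ k : Fin 12, k ≠ c ∧ adj k x ∧ adj k y ∧ ¬ adj k c) → x = y) := by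
  rcases hiso with ⟨e, he⟩ | ⟨e, he⟩
  · obtain ⟨f, hf⟩ := fcc_chart
    refine ⟨fccAdj, e.trans f.symm, ?_, fcc_adj_irrefl, fcc_link, fcc_close5⟩
    intro w w' hne
    rw [he w w' hne, Equiv.trans_apply, Equiv.trans_apply, ← hf, Equiv.apply_symm_apply,
      Equiv.apply_symm_apply]
  · obtain ⟨f, hf⟩ := hcp_chart
    refine ⟨hcpAdj, e.trans f.symm, ?_, hcp_adj_irrefl, hcp_link, hcp_close5⟩
    intro w w' hne
    rw [he w w' hne, Equiv.trans_apply, Equiv.trans_apply, ← hf, Equiv.apply_symm_apply,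
      Equiv.apply_symm_apply]

end Summit.AtomisticToContinuum.Crystallization.Theorems.ZeroDefectDensityBirth
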